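import Summits.BirchSwinnertonDyer.Rank1Residual.Additive.KimStructureOfFiveLe
import Summits.BirchSwinnertonDyer.Rank1Residual.Additive.X4RankOneKimResidue
import HarnessLib

/-!
# X4 ∧ `r_an = 1` at `p ≥ 5`: the rank-one CORNER and the NAMED RESIDUE with Kim's clause (6)
# DISCHARGED by the published fact (harvest-2's E73, `Kim2026/ShaLengthStructure.lean`, via
# `kimRankOnePartialAt_of_kim2026_of_five_le`) — one application each (cell `b2b-bsdres`, team n1011,
# sub-target T-a2r1c — FILE 5; sibling of `Additive/KimStructureOfFiveLe.lean` §3, which did the TAM rows)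

HONEST FRAMING (cell `b2b-bsdres`, run/shared/lean/b2b/bsd-rank1-residual/, verbatim in every
file): the goal of the cell is to DELETE the COMBINATION-SHAPED residual classes of the
Birch–Swinnerton-Dyer formula for ALL analytic-rank `≤ 1` elliptic curves over `ℚ` — "full BSD
formula for every rank `≤ 1` curve in class `C`" assembled STRICTLY from published theorems — so
that the rank-`≤ 1` remainder becomes exactly the CONSTRUCTION-SHAPED classes, which are TYPED
(missing-input `Prop`s), NOT attempted. This is not "finishing BSD". Team n1011: prove what is
provable now; shrink each hard class to its core with data; no claim beyond stated classes;
research routes; census output = EVIDENCE / conjecture items, never a Literature fact; RESIDUAL-MAP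
marks change only by signed lines. X4 stays CONSTRUCTION-SHAPED; §I O7 stays OPEN; nothing here is
booked. Theorems only (NO definition, NO Literature fact, NO `_holds`); the published input is the
explicit named-fact hypothesis `hE73` (flag `Kim2026-(6)-cyclic-reading` inherited); Kim's Conjecture
1.10 (`≥` half resp. both halves, p12's `X4.KimTamagawaDefect{Ge,}At`) and the Kurihara-number
certificate stay explicit hypotheses; `#print axioms` standard.

COVERAGE (stated first, referee 1 proviso): per pair, `W/ℚ` globally minimal, a prime `p ≥ 5` — ANY
reduction at `p` (Kim's Thm. 1.8 has no reduction hypothesis) — `ρ̄_{E,p}` onto (the tower is then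
Serre's theorem, carried as the binder `htower` exactly as in FILES 2–4), analytic rank `1`, a modular
parametrisation datum `D` with `p ∤ c_D` and the period transfer, `#Ш_an = q`. Numerically (EVIDENCE,
cc-eng-1 `class-closure/O7/pairs.tsv`, single source): X4 ∧ surj ∧ `r = 1` ∧ `p ≥ 5` = 835 residue
pairs (U 364 · TAM 470 · SHA 1); harvest-2's §3 made the 470 TAM rows "E73 + Conj. 1.10 `≥` + ONE
certificate"; this file adds the SHA-row corner and the named residue at `p ≥ 5` in the same currency.
The SHA-row honesty sentence stands (referee 1, CS-1 T-a2r1c proviso): on a row with `p ∣ #Ш_an` ONE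
certificate gives only the UPPER half; the LOWER half is a statement about ALL cyclic prime-level
Kurihara numbers (the `≥` side of `∂^{(1)}(δ̃) = ord_p #Ш_an + ∂^{(∞)}(δ̃)`) and is NOT
certificate-shaped; `∂^{(1)}(δ̃) ≠ ∞` itself (SOME non-zero prime-level Kurihara number) is in print
only at semistable `p` in rank one (Kim AJM 148 Cor. 1.5/1.6 via Perrin-Riou's conjecture), so at an
additive `p` it is a per-pair certificate.

## What this file proves (all `p ≥ 5`, `hK := kimRankOnePartialAt_of_kim2026_of_five_le`)

* §1 CORNER: `padicValNat_shaOrder_le_of_kim2026_of_tamagawaDefectGe_of_cert_of_five_le` (level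
  `ord_p ∏c + s + 1` ⟹ `ord_p #Ш ≤ s`), `missingUpperBoundAt_of_kim2026_…`,
  `missingPPartAt_iff_missingLowerBoundAt_of_kim2026_…`, `bsdp_iff_missingLowerBoundAt_of_kim2026_…`,
  and the level-side prediction `kuriharaNumber_eq_zero_of_kim2026_of_tamagawaDefectGe_of_lower_of_level_le_of_five_le`.
* §2 RESIDUE NAMED: `missingPPartAt_iff_exists_partial_eq_of_kim2026_of_five_le`
  (`MissingPPartAt W p ↔ ∃ m, ord_p #Ш_an = m ∧ m + ∂^{(∞)} = ∂^{(1)}` — modulo E73 + `∂^{(1)} ≠ ∞` ONLY),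
  `…_of_tamagawaDefect_of_five_le` and `bsdp_iff_exists_partial_eq_of_kim2026_of_tamagawaDefect_of_five_le`
  (`BSD(E,p) ↔ ∃ m, ord_p #Ш_an = m ∧ ∂^{(1)} = m + ord_p ∏c` — modulo E73 + Conj. 1.10 + `∂^{(1)} ≠ ∞`).

References: C.-H. Kim, Amer. J. Math. 148 (2026) 79–129 = arXiv:2203.12159v4 [Kim2022StructureSelmer]
Thm. 1.9 (6), Cor. 1.5/1.6, §1.5.1, Conj. 1.10 (PDF pp. 6–8); R. L. Miller, LMS J. Comput. Math. 14
(2011) [Miller2011LMS] Def. 1.1; cell files cells/n1011/OWNERS.md (T-a2r1c), HOME/INBOX.md 2026-08-21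
07:12Z (harvest-2 E73 / p254169).
-/

noncomputable section

open scoped Classical MatrixGroups ModularForm

open CongruenceSubgroup WeierstrassCurve Literature.NumberTheory.EllipticCurves
  Literature.NumberTheory.EllipticCurves.ModularForms
  Literature.NumberTheory.EllipticCurves.Rank1Residual
  Literature.NumberTheory.EllipticCurves.Rank1Residual.Typed

namespace Summit.BirchSwinnertonDyer.Rank1Residual.Additive

variable (W : WeierstrassCurve ℚ) [W.IsElliptic] [W.IsGloballyMinimal] (p : ℕ) [Fact p.Prime]

/-! ## §1 The corner at `p ≥ 5` (E73 + Conj. 1.10 `≥` + ONE certificate) -/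

/-- **`p ≥ 5`, level `ord_p ∏c + s + 1` ⟹ `ord_p #Ш(E/ℚ) ≤ s`** from Kim's clause (6) as PRINTED (`hE73`),
the `≥` half of Conj. 1.10 (`hGe`) and ONE `δ̃_ℓ ≢ 0 (mod p^{ord_p ∏c + s + 1})` at a cyclic
`ℓ ∈ 𝒫_{ord_p ∏c + s + 1}`. ANY reduction at `p`; per pair; nothing booked.
[cite: Kim2022StructureSelmer, Thm. 1.9 (6), Conj. 1.10 (PDF p. 8)] -/
theorem padicValNat_shaOrder_le_of_kim2026_of_tamagawaDefectGe_of_cert_of_five_le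
    (hE73 : Kim2026.kuriharaPartial_vanishingOrder_eq_padicValNat_sha_add_partialInfty_of_maninConstant)
    (hp : 5 ≤ p) (hsurj : W.HasSurjectiveModNGaloisRep p)
    (htower : ∀ n : ℕ, W.HasSurjectiveModNGaloisRep (p ^ n : ℕ)) (hL : W.entireLFunction 1 = 0)
    (hr : W.analyticRank = 1) (hfin : Finite W.sha)
    {N : ℕ} [NeZero N] (D : ModularParametrizationData W N) (hc : ¬ (p : ℤ) ∣ D.maninConstant)
    (hper : ∃ u : ℚ, ‖(u : ℚ_[p])‖ = 1 ∧ W.realPeriodRat = u * plusPeriod D.f)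
    (hGe : X4.KimTamagawaDefectGeAt W p D.f) (s : ℕ)
    (ℓ : ℕ) [Fact ℓ.Prime] (hℓ : Kato.IsKolyvaginPrime W p (padicValNat p W.tamagawaProduct + s + 1) ℓ)
    (hcyc : Nat.card {P : ((WeierstrassCurve.integralModelInt W).map
        (Int.castRingHom (ZMod ℓ))).toAffine.Point // p • P = 0} ≤ p)
    (ψ : (ℓ' : ℕ) → (ZMod ℓ')ˣ →* Multiplicative (ZMod (p ^ (padicValNat p W.tamagawaProduct + s + 1))))
    (hψ : Function.Surjective (ψ ℓ))
    (hδ : kuriharaNumber D.f (p ^ (padicValNat p W.tamagawaProduct + s + 1)) ℓ ψ ≠ 0) :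
    padicValNat p W.shaOrder ≤ s :=
  padicValNat_shaOrder_le_of_partial_of_tamagawaDefectGe_of_cert W p
    (kimRankOnePartialAt_of_kim2026_of_five_le W p hE73 hp) hsurj htower hL hr hfin D hc hper hGe s ℓ hℓ
    hcyc ψ hψ hδ

/-- **`p ≥ 5`: the UPPER half `Typed.MissingUpperBoundAt W p`** from E73 + Conj. 1.10 `≥` + ONE
certificate at level `ord_p ∏c + s + 1`, `s ≤ ord_p #Ш_an`. [cite: Kim2022StructureSelmer, Thm. 1.9 (6), Conj. 1.10 (PDF p. 8)]
[cite: Miller2011LMS, Def. 1.1] -/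
theorem missingUpperBoundAt_of_kim2026_of_tamagawaDefectGe_of_cert_of_five_le
    (hE73 : Kim2026.kuriharaPartial_vanishingOrder_eq_padicValNat_sha_add_partialInfty_of_maninConstant)
    (hp : 5 ≤ p) (hsurj : W.HasSurjectiveModNGaloisRep p)
    (htower : ∀ n : ℕ, W.HasSurjectiveModNGaloisRep (p ^ n : ℕ)) (hL : W.entireLFunction 1 = 0)
    (hr : W.analyticRank = 1) (hfin : Finite W.sha)
    {N : ℕ} [NeZero N] (D : ModularParametrizationData W N) (hc : ¬ (p : ℤ) ∣ D.maninConstant)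
    (hper : ∃ u : ℚ, ‖(u : ℚ_[p])‖ = 1 ∧ W.realPeriodRat = u * plusPeriod D.f)
    (hGe : X4.KimTamagawaDefectGeAt W p D.f) {q : ℚ} (hq : shaAn W = (q : ℂ)) (s : ℕ)
    (hs : (s : ℤ) ≤ padicValRat p q)
    (ℓ : ℕ) [Fact ℓ.Prime] (hℓ : Kato.IsKolyvaginPrime W p (padicValNat p W.tamagawaProduct + s + 1) ℓ)
    (hcyc : Nat.card {P : ((WeierstrassCurve.integralModelInt W).map
        (Int.castRingHom (ZMod ℓ))).toAffine.Point // p • P = 0} ≤ p)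
    (ψ : (ℓ' : ℕ) → (ZMod ℓ')ˣ →* Multiplicative (ZMod (p ^ (padicValNat p W.tamagawaProduct + s + 1))))
    (hψ : Function.Surjective (ψ ℓ))
    (hδ : kuriharaNumber D.f (p ^ (padicValNat p W.tamagawaProduct + s + 1)) ℓ ψ ≠ 0) :
    MissingUpperBoundAt W p :=
  missingUpperBoundAt_of_partial_of_tamagawaDefectGe_of_cert W p
    (kimRankOnePartialAt_of_kim2026_of_five_le W p hE73 hp) hsurj htower hL hr hfin D hc hper hGe hq s hs
    ℓ hℓ hcyc ψ hψ hδ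

/-- **`p ≥ 5`, THE CORNER: `Typed.MissingPPartAt W p ↔ Typed.MissingLowerBoundAt W p`** from E73 +
Conj. 1.10 `≥` + ONE certificate at level `ord_p ∏c + s + 1`, `s ≤ ord_p #Ш_an`. On a `p ∣ #Ш_an` row
the LOWER half is NOT certificate-shaped (all cyclic prime-level Kurihara numbers). Per pair; ANY
reduction; nothing booked. [cite: Kim2022StructureSelmer, Thm. 1.9 (6), Conj. 1.10 (PDF p. 8)] [cite: Miller2011LMS, Def. 1.1] -/
theorem missingPPartAt_iff_missingLowerBoundAt_of_kim2026_of_tamagawaDefectGe_of_cert_of_five_le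
    (hE73 : Kim2026.kuriharaPartial_vanishingOrder_eq_padicValNat_sha_add_partialInfty_of_maninConstant)
    (hp : 5 ≤ p) (hsurj : W.HasSurjectiveModNGaloisRep p)
    (htower : ∀ n : ℕ, W.HasSurjectiveModNGaloisRep (p ^ n : ℕ)) (hL : W.entireLFunction 1 = 0)
    (hr : W.analyticRank = 1) (hfin : Finite W.sha)
    {N : ℕ} [NeZero N] (D : ModularParametrizationData W N) (hc : ¬ (p : ℤ) ∣ D.maninConstant)
    (hper : ∃ u : ℚ, ‖(u : ℚ_[p])‖ = 1 ∧ W.realPeriodRat = u * plusPeriod D.f)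
    (hGe : X4.KimTamagawaDefectGeAt W p D.f) {q : ℚ} (hq : shaAn W = (q : ℂ)) (s : ℕ)
    (hs : (s : ℤ) ≤ padicValRat p q)
    (ℓ : ℕ) [Fact ℓ.Prime] (hℓ : Kato.IsKolyvaginPrime W p (padicValNat p W.tamagawaProduct + s + 1) ℓ)
    (hcyc : Nat.card {P : ((WeierstrassCurve.integralModelInt W).map
        (Int.castRingHom (ZMod ℓ))).toAffine.Point // p • P = 0} ≤ p)
    (ψ : (ℓ' : ℕ) → (ZMod ℓ')ˣ →* Multiplicative (ZMod (p ^ (padicValNat p W.tamagawaProduct + s + 1))))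
    (hψ : Function.Surjective (ψ ℓ))
    (hδ : kuriharaNumber D.f (p ^ (padicValNat p W.tamagawaProduct + s + 1)) ℓ ψ ≠ 0) :
    MissingPPartAt W p ↔ MissingLowerBoundAt W p :=
  missingPPartAt_iff_missingLowerBoundAt_of_partial_of_tamagawaDefectGe_of_cert W p
    (kimRankOnePartialAt_of_kim2026_of_five_le W p hE73 hp) hsurj htower hL hr hfin D hc hper hGe hq s hs
    ℓ hℓ hcyc ψ hψ hδ

/-- **`p ≥ 5`: `BSD(E,p) ↔ Typed.MissingLowerBoundAt W p`** from E73 + Conj. 1.10 `≥` + ONE certificate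
(`hGZK`, `hmod` supply `L(E,1) = 0` and `Ш` finite). Per pair; ANY reduction; nothing booked.
[cite: Kim2022StructureSelmer, Thm. 1.9 (6), Conj. 1.10 (PDF p. 8)] [cite: Miller2011LMS, §1 and Def. 1.1] -/
theorem bsdp_iff_missingLowerBoundAt_of_kim2026_of_tamagawaDefectGe_of_cert_of_five_le
    (hE73 : Kim2026.kuriharaPartial_vanishingOrder_eq_padicValNat_sha_add_partialInfty_of_maninConstant)
    (hp : 5 ≤ p) (hGZK : rank_eq_analyticRank_of_analyticRank_le_one) (hmod : hasEntireLFunction_rat)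
    (hsurj : W.HasSurjectiveModNGaloisRep p)
    (htower : ∀ n : ℕ, W.HasSurjectiveModNGaloisRep (p ^ n : ℕ)) (hr : W.analyticRank = 1)
    {N : ℕ} [NeZero N] (D : ModularParametrizationData W N) (hc : ¬ (p : ℤ) ∣ D.maninConstant)
    (hper : ∃ u : ℚ, ‖(u : ℚ_[p])‖ = 1 ∧ W.realPeriodRat = u * plusPeriod D.f)
    (hGe : X4.KimTamagawaDefectGeAt W p D.f) {q : ℚ} (hq : shaAn W = (q : ℂ)) (s : ℕ)
    (hs : (s : ℤ) ≤ padicValRat p q)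
    (ℓ : ℕ) [Fact ℓ.Prime] (hℓ : Kato.IsKolyvaginPrime W p (padicValNat p W.tamagawaProduct + s + 1) ℓ)
    (hcyc : Nat.card {P : ((WeierstrassCurve.integralModelInt W).map
        (Int.castRingHom (ZMod ℓ))).toAffine.Point // p • P = 0} ≤ p)
    (ψ : (ℓ' : ℕ) → (ZMod ℓ')ˣ →* Multiplicative (ZMod (p ^ (padicValNat p W.tamagawaProduct + s + 1))))
    (hψ : Function.Surjective (ψ ℓ))
    (hδ : kuriharaNumber D.f (p ^ (padicValNat p W.tamagawaProduct + s + 1)) ℓ ψ ≠ 0) :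
    BSDp W p ↔ MissingLowerBoundAt W p :=
  bsdp_iff_missingLowerBoundAt_of_partial_of_tamagawaDefectGe_of_cert W p
    (kimRankOnePartialAt_of_kim2026_of_five_le W p hE73 hp) hGZK hmod hsurj htower hr D hc hper hGe hq s
    hs ℓ hℓ hcyc ψ hψ hδ

/-- **`p ≥ 5`, LEVEL-SIDE PREDICTION**: granted E73, Conj. 1.10 `≥` and the LOWER half at the pair, NO
Kurihara number is non-zero mod `p^k` at a cyclic Kolyvagin prime of level `k ≤ ord_p ∏c + ord_p #Ш_an`.
Rank one; per pair; an earlier non-zero value refutes {Conj. 1.10 `≥`, LOWER} at the pair (E73 being a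
theorem). [cite: Kim2022StructureSelmer, §1.5.1 and Conj. 1.10 (PDF pp. 7–8)] [cite: Miller2011LMS, Def. 1.1] -/
theorem kuriharaNumber_eq_zero_of_kim2026_of_tamagawaDefectGe_of_lower_of_level_le_of_five_le
    (hE73 : Kim2026.kuriharaPartial_vanishingOrder_eq_padicValNat_sha_add_partialInfty_of_maninConstant)
    (hp : 5 ≤ p) (hsurj : W.HasSurjectiveModNGaloisRep p)
    (htower : ∀ n : ℕ, W.HasSurjectiveModNGaloisRep (p ^ n : ℕ)) (hL : W.entireLFunction 1 = 0)
    (hr : W.analyticRank = 1) (hfin : Finite W.sha)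
    {N : ℕ} [NeZero N] (D : ModularParametrizationData W N) (hc : ¬ (p : ℤ) ∣ D.maninConstant)
    (hper : ∃ u : ℚ, ‖(u : ℚ_[p])‖ = 1 ∧ W.realPeriodRat = u * plusPeriod D.f)
    (hGe : X4.KimTamagawaDefectGeAt W p D.f) {q : ℚ} (hq : shaAn W = (q : ℂ))
    (hlow : MissingLowerBoundAt W p)
    {k : ℕ} (hk : 1 ≤ k) (hkle : (k : ℤ) ≤ padicValNat p W.tamagawaProduct + padicValRat p q)
    (ℓ : ℕ) [Fact ℓ.Prime] (hℓ : Kato.IsKolyvaginPrime W p k ℓ)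
    (hcyc : Nat.card {P : ((WeierstrassCurve.integralModelInt W).map
        (Int.castRingHom (ZMod ℓ))).toAffine.Point // p • P = 0} ≤ p)
    (ψ : (ℓ' : ℕ) → (ZMod ℓ')ˣ →* Multiplicative (ZMod (p ^ k)))
    (hψ : Function.Surjective (ψ ℓ)) : kuriharaNumber D.f (p ^ k) ℓ ψ = 0 :=
  kuriharaNumber_eq_zero_of_partial_of_tamagawaDefectGe_of_lower_of_level_le W p
    (kimRankOnePartialAt_of_kim2026_of_five_le W p hE73 hp) hsurj htower hL hr hfin D hc hper hGe hq
    hlow hk hkle ℓ hℓ hcyc ψ hψ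

/-! ## §2 The residue NAMED at `p ≥ 5` (E73 + `∂^{(1)} ≠ ∞`; + Conj. 1.10 for the `∏c` form) -/

/-- **`p ≥ 5`, THE RANK-ONE RESIDUE NAMED, modulo E73 and ONE non-zero prime-level Kurihara number
only**: `Typed.MissingPPartAt W p ↔ ∃ m : ℕ, ord_p #Ш_an = m ∧ m + ∂^{(∞)}(δ̃) = ∂^{(1)}(δ̃)`. No
Conjecture 1.10 here. Per pair; ANY reduction; nothing booked.
[cite: Kim2022StructureSelmer, Thm. 1.9 (6) and §1.5.1 (PDF pp. 7–8)] [cite: Miller2011LMS, Def. 1.1] -/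
theorem missingPPartAt_iff_exists_partial_eq_of_kim2026_of_five_le
    (hE73 : Kim2026.kuriharaPartial_vanishingOrder_eq_padicValNat_sha_add_partialInfty_of_maninConstant)
    (hp : 5 ≤ p) (hsurj : W.HasSurjectiveModNGaloisRep p)
    (htower : ∀ n : ℕ, W.HasSurjectiveModNGaloisRep (p ^ n : ℕ)) (hL : W.entireLFunction 1 = 0)
    (hr : W.analyticRank = 1) (hfin : Finite W.sha)
    {N : ℕ} [NeZero N] (D : ModularParametrizationData W N) (hc : ¬ (p : ℤ) ∣ D.maninConstant)
    (hper : ∃ u : ℚ, ‖(u : ℚ_[p])‖ = 1 ∧ W.realPeriodRat = u * plusPeriod D.f)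
    (hne : kuriharaPartial W p D.f 1 ≠ ⊤) {q : ℚ} (hq : shaAn W = (q : ℂ)) :
    MissingPPartAt W p ↔
      ∃ m : ℕ, padicValRat p q = m ∧
        (m : ℕ∞) + kuriharaPartialInfty W p D.f = kuriharaPartial W p D.f 1 :=
  missingPPartAt_iff_exists_partial_eq_of_kimRankOnePartialAt W p
    (kimRankOnePartialAt_of_kim2026_of_five_le W p hE73 hp) hsurj htower hL hr hfin D hc hper hne hq

/-- **`p ≥ 5`, with Conj. 1.10 at the pair**: `Typed.MissingPPartAt W p ↔ ∃ m : ℕ, ord_p #Ш_an = m ∧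
∂^{(1)}(δ̃) = m + ord_p ∏_ℓ c_ℓ`, modulo E73 + `X4.KimTamagawaDefectAt W p D.f` + `∂^{(1)} ≠ ∞`.
[cite: Kim2022StructureSelmer, Thm. 1.9 (6), §1.5.1 and Conj. 1.10 (PDF pp. 7–8)] [cite: Miller2011LMS, Def. 1.1] -/
theorem missingPPartAt_iff_exists_partial_eq_of_kim2026_of_tamagawaDefect_of_five_le
    (hE73 : Kim2026.kuriharaPartial_vanishingOrder_eq_padicValNat_sha_add_partialInfty_of_maninConstant)
    (hp : 5 ≤ p) (hsurj : W.HasSurjectiveModNGaloisRep p)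
    (htower : ∀ n : ℕ, W.HasSurjectiveModNGaloisRep (p ^ n : ℕ)) (hL : W.entireLFunction 1 = 0)
    (hr : W.analyticRank = 1) (hfin : Finite W.sha)
    {N : ℕ} [NeZero N] (D : ModularParametrizationData W N) (hc : ¬ (p : ℤ) ∣ D.maninConstant)
    (hper : ∃ u : ℚ, ‖(u : ℚ_[p])‖ = 1 ∧ W.realPeriodRat = u * plusPeriod D.f)
    (hne : kuriharaPartial W p D.f 1 ≠ ⊤) (hT : X4.KimTamagawaDefectAt W p D.f)
    {q : ℚ} (hq : shaAn W = (q : ℂ)) :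
    MissingPPartAt W p ↔
      ∃ m : ℕ, padicValRat p q = m ∧
        ((m + padicValNat p W.tamagawaProduct : ℕ) : ℕ∞) = kuriharaPartial W p D.f 1 :=
  missingPPartAt_iff_exists_partial_eq_of_kimRankOnePartialAt_of_tamagawaDefect W p
    (kimRankOnePartialAt_of_kim2026_of_five_le W p hE73 hp) hsurj htower hL hr hfin D hc hper hne hT hq

/-- **`p ≥ 5`: `BSD(E,p) ↔ ∃ m : ℕ, ord_p #Ш_an = m ∧ ∂^{(1)}(δ̃) = m + ord_p ∏c`**, modulo E73 + Conj. 1.10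
at the pair + `∂^{(1)} ≠ ∞` (`hGZK`, `hmod`). The O7 ∩ X4 ∧ surj rank-one residue at a `p ≥ 5` pair,
named: an identity between the first Kurihara invariant, the analytic order of `Ш` and the Tamagawa
product. Per pair; ANY reduction; nothing booked.
[cite: Kim2022StructureSelmer, Thm. 1.9 (6), §1.5.1 and Conj. 1.10 (PDF pp. 7–8)] [cite: Miller2011LMS, §1 and Def. 1.1] -/
theorem bsdp_iff_exists_partial_eq_of_kim2026_of_tamagawaDefect_of_five_le
    (hE73 : Kim2026.kuriharaPartial_vanishingOrder_eq_padicValNat_sha_add_partialInfty_of_maninConstant)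
    (hp : 5 ≤ p) (hGZK : rank_eq_analyticRank_of_analyticRank_le_one) (hmod : hasEntireLFunction_rat)
    (hsurj : W.HasSurjectiveModNGaloisRep p)
    (htower : ∀ n : ℕ, W.HasSurjectiveModNGaloisRep (p ^ n : ℕ)) (hr : W.analyticRank = 1)
    {N : ℕ} [NeZero N] (D : ModularParametrizationData W N) (hc : ¬ (p : ℤ) ∣ D.maninConstant)
    (hper : ∃ u : ℚ, ‖(u : ℚ_[p])‖ = 1 ∧ W.realPeriodRat = u * plusPeriod D.f)
    (hne : kuriharaPartial W p D.f 1 ≠ ⊤) (hT : X4.KimTamagawaDefectAt W p D.f)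
    {q : ℚ} (hq : shaAn W = (q : ℂ)) :
    BSDp W p ↔
      ∃ m : ℕ, padicValRat p q = m ∧
        ((m + padicValNat p W.tamagawaProduct : ℕ) : ℕ∞) = kuriharaPartial W p D.f 1 :=
  bsdp_iff_exists_partial_eq_of_kimRankOnePartialAt_of_tamagawaDefect W p
    (kimRankOnePartialAt_of_kim2026_of_five_le W p hE73 hp) hGZK hmod hsurj htower hr D hc hper hne hT hq

end Summit.BirchSwinnertonDyer.Rank1Residual.Additive

end
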